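import Literature.NumberTheory.Rogawski1990.ArchOrbFamGSmoothModelParam        -- ★ (A4′) p851133 (LH5-p02 (g4)): `contDiffOn_smoothModel_prod_param`, `isOpen_setOf_inRegAt`; brings ★ (A4) `contDiff_coe_gprimeBlock`, `contDiff_coe_torusFamily_comp`, `continuous_of_coe`, `boostEig`
import Literature.NumberTheory.Automorphic.ArchTorusOrbitalFubiniSmooth            -- ★ `isCompact_setOf_coe_archLocal_mem` (matrix-compact ⇒ group-compact in `U(α)_w`)
import Literature.NumberTheory.Automorphic.UnitaryFormGroupTestFunctionExtension    -- ★ `isClosedEmbedding_coe_unitaryGroupOfForm` (`U(J) ↪ M₃(ℂ)` closed)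
import HarnessLib

/-!
# (B3-JUNCTION) J2-b — the PARTIAL unfolded model at a compact place `w₀`: jointly `C^∞` in (coordinates, `w₀`-matrix slot), uniform compact `G_{w₀}`-support
# (Varadarajan 1977 I §1.12; Rogawski 1990 §8.2–8.3; Hörmander ALPDO I Thm. 1.1.9 — through ★ (A4′))

Topic `NumberTheory/Rogawski1990`; namespaces `Literature.NumberTheory.Rogawski1990` (§1 recombination) and `Literature.NumberTheory.Automorphic.UnitaryGroup` (§2–§3).
THEOREMS ONLY (no `def`, no instance, no notation, no axiom, no named fact, no `sorry`).  Cell `pub/hodgecm-mathlib`, crux H413 (`stmt-HodgeConjecture-24833`), F0∕P3c line LH3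
(closer stub `stub_N9`, leaf v5.1), organ O-L1d `stub_N9hcCentralJetBounds`; brick **(B3-JUNCTION) J2-b** (LH3-plan (g4) DEAL 2026-09-02T11:14:03Z + RULING 11:26:38Z «A-p12 KEEPS J2»;
seat A-p12 (g28)).  Supplies the binders `hΘ` (joint smoothness on `O ×ˢ univ`) and `hΘc` (ONE compact `G_{w₀}`-support) of ★ J1 `exists_nhds_bddAbove_norm_iteratedFDeriv_orbFamGExt_of_centralModel`
(`ArchOrbFamGExtCentralJetModel`, p851263) for the PARTIAL UNFOLDED MODEL.  Count-neutral.

THE MATHEMATICS.  Fix a compact place `w₀`.  The partial unfolded model is the (A5a) integrand with the `w₀`-slot opened up as a free MATRIX variable `X ∈ M₃(ℂ)`: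
`Θ(c, X) = ∫_{((Π_{i} U_i)⧸Π T′_i) × (Π_{j∈S′} K×N)} φ̃( recombine( X at w₀ ∣ (ḡ_i γ_i(c) ḡ_i⁻¹)_i at the compact places i ∉ S′, i ≠ w₀ ∣ (T_j⁻¹ · k_j τ(0,φ_j,θ_j) τ(x_j∕2,0,0) n_j τ(x_j∕2,0,0) k_j⁻¹ · T_j)_j at j ∈ S′ ) )`
where `φ̃ ∈ C_c^∞(M₃(L ⊗ ℝ))` is the ambient lift of the test function (★ `ArchSmooth.exists_contDiff`), `T_j ∈ GL₃(ℂ)` the split frames, `τ` the boost torus family, `K ≤ U(J₃)(ℂ)` compact.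
§3 HEAD: `Θ` is `ContDiffOn ℝ ∞` on `{c | in-regular at every compact i ≠ w₀} ×ˢ univ` — ONE call of ★ (A4′) `contDiffOn_smoothModel_prod_param` with the extra parameter `Z := M₃(ℂ)`,
`T := univ`, fibre `Y := Π_{S′} (K × N)`, and the smooth factorisation `F q g η = Θ̃(((↑↑g_i)_i, r η), q)` through the LINEAR 3-slot recombination (§1); the support clause `hFsupp` is read
MATRIX-SIDE (`φ̃ ≠ 0 ⇒` every block of the recombined matrix lies in a compact ⇒ `g_i`, `u_j` in compacts by the closed embeddings ★ `isCompact_setOf_coe_archLocal_mem`, ★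
`isClosedEmbedding_coe_unitaryGroupOfForm`, and `n_j` by the continuous word inversion of ★ (A4)'s `S₁∕N₀` step).  §3 also gives the uniform compact `G_{w₀}`-support: `Θ(c, ↑↑k) = 0` for `k`
off ONE compact of `U(α)_{w₀}`, for every `c` (the `w₀`-block of `tsupport φ̃`).  The identity «`Θ(c, ↑↑x)` = the inner integral of the isolated unfolded model» is (J2-a)∕(J2-c)'s.
HONEST LABEL: HC_CM is proved only modulo the 7 printed citations (2 remaining: hLiu418 = `stmt-HodgeConjecture-24832`, h413 = `stmt-HodgeConjecture-24833`) until rung 0 closes; this file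
moves no row of the books.

## References
* [Varadarajan1977] V. S. Varadarajan, *Harmonic Analysis on Real Reductive Groups*, LNM 576 (1977), Part I §1.12 (descent: the other places as smooth parameters).
* [Rogawski1990] J. D. Rogawski, *Automorphic Representations of Unitary Groups in Three Variables*, Ann. of Math. Stud. 123 (1990), §4.9 p. 55; §8.2 p. 122; §8.3 p. 124.
* [HormanderALPDO1] L. Hörmander, *The Analysis of Linear Partial Differential Operators I*, Grundlehren 256 (1983), §1.1 Thm. 1.1.9.
* [BorelJacquet1979] A. Borel, H. Jacquet, *Automorphic forms and automorphic representations*, PSPM 33.1 (1979), §4.1 (`G_∞ = Π_v G(F_v)`).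
* [DeitmarEchterhoff2014] A. Deitmar, S. Echterhoff, *Principles of Harmonic Analysis*, 2nd ed. (2014), Lemma 9.3.3.
-/

set_option autoImplicit false

noncomputable section

open MeasureTheory MeasureTheory.Measure Matrix NumberField NumberField.InfinitePlace NumberField.mixedEmbedding Set Function Topology Complex
open Literature.MeasureTheory.Group Literature.NumberTheory.Rogawski1990 Literature.NumberTheory.Automorphic.ArchCartan
open Literature.NumberTheory.Automorphic.UnitaryGroup
open scoped MatrixGroups ContDiff Classical
open scoped Matrix.Norms.Operator

/-! ## §1 The 3-slot recombination «`w₀`-slot ∣ compact places `≠ w₀` ∣ split places» is LINEAR in the ambient matrices -/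

namespace Literature.NumberTheory.Rogawski1990

section Recombine3

variable (L : Type) [Field L] [NumberField L] (S' : Finset {w : InfinitePlace L // IsComplex w}) (w₀ : {w : InfinitePlace L // IsComplex w})

/-- **The 3-slot recombination is ℝ-linear, hence `C^∞`**: `(X, m_g, m_u) ↦ Matrix.of (a, b) ↦ (0, w ↦ [w ∈ S′] m_u(w)_{ab} ∣ [w = w₀] X_{ab} ∣ [else] m_g(w)_{ab})` into
`M₃(L ⊗ ℝ)` (the `w₀`-slot free; twin of ★ `exists_contDiff_recombineMatrix` with a third case). [cite: BorelJacquet1979, §4.1] -/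
theorem exists_contDiff_recombineMatrix₃ :
    ∃ Λ : (Matrix (Fin 3) (Fin 3) ℂ × (({w : {w : InfinitePlace L // IsComplex w} // w ∉ S' ∧ w ≠ w₀} → Matrix (Fin 3) (Fin 3) ℂ) ×
        (↥S' → Matrix (Fin 3) (Fin 3) ℂ))) → Matrix (Fin 3) (Fin 3) (mixedSpace L),
      ContDiff ℝ ∞ Λ ∧ ∀ X mg mu, Λ (X, (mg, mu)) = Matrix.of fun a b => ((0 : {w : InfinitePlace L // IsReal w} → ℝ),
        fun w : {w : InfinitePlace L // IsComplex w} =>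
          if h : w ∈ S' then mu ⟨w, h⟩ a b else if hw : w = w₀ then X a b else mg ⟨w, ⟨h, hw⟩⟩ a b) := by
  classical
  let Λ : (Matrix (Fin 3) (Fin 3) ℂ × (({w : {w : InfinitePlace L // IsComplex w} // w ∉ S' ∧ w ≠ w₀} → Matrix (Fin 3) (Fin 3) ℂ) ×
      (↥S' → Matrix (Fin 3) (Fin 3) ℂ))) →ₗ[ℝ] Matrix (Fin 3) (Fin 3) (mixedSpace L) :=
    { toFun := fun p => Matrix.of fun a b => ((0 : {w : InfinitePlace L // IsReal w} → ℝ),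
        fun w : {w : InfinitePlace L // IsComplex w} =>
          if h : w ∈ S' then p.2.2 ⟨w, h⟩ a b else if hw : w = w₀ then p.1 a b else p.2.1 ⟨w, ⟨h, hw⟩⟩ a b)
      map_add' := fun p q => by
        ext a b
        · simp
        · rename_i w
          simp only [Prod.fst_add, Prod.snd_add, Matrix.of_apply, Matrix.add_apply, Pi.add_apply]
          split_ifs <;> rfl
      map_smul' := fun c p => by
        ext a b
        · simp
        · rename_i w
          simp only [Prod.smul_fst, Prod.smul_snd, Matrix.of_apply, Matrix.smul_apply, RingHom.id_apply, Pi.smul_apply]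
          split_ifs <;> rfl }
  exact ⟨Λ, (LinearMap.toContinuousLinearMap Λ).contDiff, fun X mg mu => rfl⟩

omit [NumberField L] in
/-- **Reading a complex block** of `M₃(L ⊗ ℝ) = M₃((Π_{real} ℝ) × (Π_{complex} ℂ))` at the place `w` is continuous. [cite: BorelJacquet1979, §4.1] -/
theorem continuous_readBlock (w : {w : InfinitePlace L // IsComplex w}) :
    Continuous fun M : Matrix (Fin 3) (Fin 3) (mixedSpace L) => (Matrix.of fun a b => (M a b).2 w : Matrix (Fin 3) (Fin 3) ℂ) := by
  refine continuous_matrix fun a b => ?_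
  exact (continuous_apply w).comp (continuous_snd.comp ((continuous_apply b).comp ((continuous_apply a).comp continuous_id)))

end Recombine3

end Literature.NumberTheory.Rogawski1990

/-! ## §2–§3 The partial unfolded model: joint smoothness through ★ (A4′), uniform compact `G_{w₀}`-support -/

namespace Literature.NumberTheory.Automorphic.UnitaryGroup

section PartialModel

variable (L : Type) [Field L] [NumberField L] [IsCMField L] (α : Fin 3 → L) (S' : Finset {w : InfinitePlace L // IsComplex w})
  (w₀ : {w : InfinitePlace L // IsComplex w})

/-- **(B3-JUNCTION) J2-b HEAD — THE PARTIAL UNFOLDED MODEL IS JOINTLY `C^∞` IN (COORDINATES, `w₀`-MATRIX SLOT).**  Frame data `hα hreal hS′`; the compact places OTHER than `w₀`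
indexed by the flat subtype `{w ∕∕ w ∉ S′ ∧ w ≠ w₀}` with a measure `μ` finite on compacta on their chart quotient `(Π_i U(α)_i) ⧸ Π_i T′_{S′,i}`; the standard split group `U(J₃)(ℂ)`
(`hJ`) with ONE compact subgroup `K`, an s-finite measure `ν` finite on compacta on the split fibre `Π_{S′} (K × N)`, the boost torus family through its matrix (`hτcoe`), the split
frames as fixed `T_j ∈ GL₃(ℂ)` (the `w ∈ S′` component reads `T_j⁻¹ · ↑↑(k_j τ(0,φ_j,θ_j) τ(x_j∕2,0,0) n_j τ(x_j∕2,0,0) k_j⁻¹) · T_j`), and an ambient test function `φ̃ ∈ C_c^∞(M₃(L ⊗ ℝ))`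
(★ `ArchSmooth.exists_contDiff`).  THEN the partial unfolded model
`(c, X) ↦ ∫_{quotient × fibre} descConj γ(c) (φ̃ ∘ recombine(X ∣ (↑↑(ḡ_i γ_i(c) ḡ_i⁻¹))_i ∣ split words(c)))`
is `ContDiffOn ℝ ∞` on `{c | in-regular at every compact i ∉ S′, i ≠ w₀} ×ˢ univ` — ★ (A4′) `contDiffOn_smoothModel_prod_param` at `Z := M₃(ℂ)`, `T := univ`, with the linear 3-slot
recombination (§1) inside the smooth factorisation and the support clause read matrix-side (closed embeddings ★ `isCompact_setOf_coe_archLocal_mem`, ★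
`isClosedEmbedding_coe_unitaryGroupOfForm`; the `n_j` by the continuous word inversion).  The `hΘ` binder of ★ J1 `…_of_centralModel` for the central road.
[cite: Varadarajan1977, I §1.12] [cite: Rogawski1990, §4.9 p. 55; §8.2 p. 122; §8.3 p. 124] [cite: HormanderALPDO1, §1.1 Thm. 1.1.9] -/
theorem contDiffOn_partialUnfoldedModel (hα : ∀ i, α i ≠ 0) (hreal : ∀ (w : {w : InfinitePlace L // IsComplex w}) (i : Fin 3), (w.1.embedding (α i)).im = 0)
    (hS' : ∀ w, w ∈ S' → w ∈ splitChartPlaces L α)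
    [MeasurableSpace ((∀ i : {w : {w : InfinitePlace L // IsComplex w} // w ∉ S' ∧ w ≠ w₀}, ↥(archLocal L 3 (Matrix.diagonal α) i.1)) ⧸
      Subgroup.pi Set.univ (fun i : {w : {w : InfinitePlace L // IsComplex w} // w ∉ S' ∧ w ≠ w₀} => chartTorusGLoc L α i.1 S'))]
    [BorelSpace ((∀ i : {w : {w : InfinitePlace L // IsComplex w} // w ∉ S' ∧ w ≠ w₀}, ↥(archLocal L 3 (Matrix.diagonal α) i.1)) ⧸
      Subgroup.pi Set.univ (fun i : {w : {w : InfinitePlace L // IsComplex w} // w ∉ S' ∧ w ≠ w₀} => chartTorusGLoc L α i.1 S'))]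
    (μ : Measure ((∀ i : {w : {w : InfinitePlace L // IsComplex w} // w ∉ S' ∧ w ≠ w₀}, ↥(archLocal L 3 (Matrix.diagonal α) i.1)) ⧸
      Subgroup.pi Set.univ (fun i : {w : {w : InfinitePlace L // IsComplex w} // w ∉ S' ∧ w ≠ w₀} => chartTorusGLoc L α i.1 S')))
    [IsFiniteMeasureOnCompacts μ]
    {J : Matrix (Fin 3) (Fin 3) ℂ} (hJ : J = (StdForm.antidiagonal 3).over ℂ)
    [MeasurableSpace ↥(unitaryGroupOfForm (starRingEnd ℂ) J)] [BorelSpace ↥(unitaryGroupOfForm (starRingEnd ℂ) J)]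
    (K : Subgroup ↥(unitaryGroupOfForm (starRingEnd ℂ) J)) (hK : IsCompact (K : Set ↥(unitaryGroupOfForm (starRingEnd ℂ) J)))
    (ν : Measure (↥S' → ↥K × ↥(unipotentU (starRingEnd ℂ) J))) [IsFiniteMeasureOnCompacts ν] [SFinite ν]
    (τ : (Fin 3 → ℝ) → ↥(unitaryGroupOfForm (starRingEnd ℂ) J))
    (hτcoe : ∀ c, (((τ c : ↥(unitaryGroupOfForm (starRingEnd ℂ) J)) : GL (Fin 3) ℂ) : Matrix (Fin 3) (Fin 3) ℂ) = Matrix.diagonal (boostEig c))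
    (T : ↥S' → GL (Fin 3) ℂ)
    (φ : Matrix (Fin 3) (Fin 3) (mixedSpace L) → ℂ) (hφ : ContDiff ℝ ∞ φ) (hφc : HasCompactSupport φ) :
    ContDiffOn ℝ ∞ (fun q : ({w : InfinitePlace L // IsComplex w} → Fin 3 → ℝ) × Matrix (Fin 3) (Fin 3) ℂ =>
        ∫ p : ((∀ i : {w : {w : InfinitePlace L // IsComplex w} // w ∉ S' ∧ w ≠ w₀}, ↥(archLocal L 3 (Matrix.diagonal α) i.1)) ⧸
              Subgroup.pi Set.univ (fun i : {w : {w : InfinitePlace L // IsComplex w} // w ∉ S' ∧ w ≠ w₀} => chartTorusGLoc L α i.1 S')) ×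
            (↥S' → ↥K × ↥(unipotentU (starRingEnd ℂ) J)),
          descConj (fun i : {w : {w : InfinitePlace L // IsComplex w} // w ∉ S' ∧ w ≠ w₀} => gprimeBlock L α i.1 S' q.1)
            (Subgroup.pi Set.univ (fun i : {w : {w : InfinitePlace L // IsComplex w} // w ∉ S' ∧ w ≠ w₀} => chartTorusGLoc L α i.1 S'))
            (forall_mem_pi_chartTorusGLoc_comm L α S' (fun i : {w : {w : InfinitePlace L // IsComplex w} // w ∉ S' ∧ w ≠ w₀} => i.1) q.1)
            (fun g => φ (Matrix.of fun a b => ((0 : {w : InfinitePlace L // IsReal w} → ℝ),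
              fun w : {w : InfinitePlace L // IsComplex w} =>
                if h : w ∈ S' then
                  ((((T ⟨w, h⟩)⁻¹ : GL (Fin 3) ℂ) : Matrix (Fin 3) (Fin 3) ℂ) *
                    (((((p.2 ⟨w, h⟩).1 : ↥(unitaryGroupOfForm (starRingEnd ℂ) J)) *
                        (τ ![0, q.1 w 1, q.1 w 2] * τ ![q.1 w 0 / 2, 0, 0] * ((p.2 ⟨w, h⟩).2 : ↥(unitaryGroupOfForm (starRingEnd ℂ) J)) * τ ![q.1 w 0 / 2, 0, 0]) *
                        ((p.2 ⟨w, h⟩).1 : ↥(unitaryGroupOfForm (starRingEnd ℂ) J))⁻¹ : ↥(unitaryGroupOfForm (starRingEnd ℂ) J)) : GL (Fin 3) ℂ) : Matrix (Fin 3) (Fin 3) ℂ) *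
                    ((T ⟨w, h⟩ : GL (Fin 3) ℂ) : Matrix (Fin 3) (Fin 3) ℂ)) a b
                else if hw : w = w₀ then q.2 a b
                else ((((g ⟨w, ⟨h, hw⟩⟩ : ↥(archLocal L 3 (Matrix.diagonal α) w)) : GL (Fin 3) ℂ) : Matrix (Fin 3) (Fin 3) ℂ)) a b)))
            p.1 ∂(μ.prod ν))
      ({c : {w : InfinitePlace L // IsComplex w} → Fin 3 → ℝ |
        ∀ (i : {w : {w : InfinitePlace L // IsComplex w} // w ∉ S' ∧ w ≠ w₀}) (a b : Fin 3), a ≠ b →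
          slotSign L α i.1 a ≠ slotSign L α i.1 b → Circle.exp (c i.1 a) ≠ Circle.exp (c i.1 b)} ×ˢ (univ : Set (Matrix (Fin 3) (Fin 3) ℂ))) := by
  -- frame facts and instances
  have hN : IsClosed (unipotentU (starRingEnd ℂ) J : Set ↥(unitaryGroupOfForm (starRingEnd ℂ) J)) := LineRing.isClosed_unipotentU _ _
  have hJJ : J * J = 1 := by rw [hJ]; exact StdForm.over_mul_over _ _
  have hJdet : J.det ≠ 0 := by
    intro h0
    have h1 := congrArg Matrix.det hJJ
    rw [Matrix.det_mul, h0, zero_mul, Matrix.det_one] at h1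
    exact zero_ne_one h1
  haveI : LocallyCompactSpace ↥(unitaryGroupOfForm (starRingEnd ℂ) J) := locallyCompactSpace_unitaryGroupOfForm_complex J
  haveI : SecondCountableTopology ↥(unitaryGroupOfForm (starRingEnd ℂ) J) := secondCountableTopology_unitaryGroupOfForm_complex J
  haveI : SecondCountableTopology ↥(unipotentU (starRingEnd ℂ) J) := TopologicalSpace.Subtype.secondCountableTopology _
  haveI : SecondCountableTopology ↥K := TopologicalSpace.Subtype.secondCountableTopology _
  haveI : BorelSpace ↥(unipotentU (starRingEnd ℂ) J) := Subtype.borelSpace _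
  haveI : BorelSpace ↥K := Subtype.borelSpace _
  haveI : BorelSpace (↥K × ↥(unipotentU (starRingEnd ℂ) J)) := Prod.borelSpace
  haveI : CompactSpace ↥K := isCompact_iff_compactSpace.1 hK
  -- the 3-slot recombination
  obtain ⟨Λ, hΛ, hΛapply⟩ := exists_contDiff_recombineMatrix₃ L S' w₀
  -- the fibre datum `r(η) = (↑↑k_j, ↑↑n_j, ↑↑k_j⁻¹)_j`
  have hcoe : Continuous fun u : ↥(unitaryGroupOfForm (starRingEnd ℂ) J) => ((u : GL (Fin 3) ℂ) : Matrix (Fin 3) (Fin 3) ℂ) :=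
    Units.continuous_val.comp continuous_subtype_val
  let r : (↥S' → ↥K × ↥(unipotentU (starRingEnd ℂ) J)) → (↥S' → Matrix (Fin 3) (Fin 3) ℂ × Matrix (Fin 3) (Fin 3) ℂ × Matrix (Fin 3) (Fin 3) ℂ) :=
    fun η j => ((((((η j).1 : ↥K) : ↥(unitaryGroupOfForm (starRingEnd ℂ) J)) : GL (Fin 3) ℂ) : Matrix (Fin 3) (Fin 3) ℂ),
      (((((η j).2 : ↥(unipotentU (starRingEnd ℂ) J)) : ↥(unitaryGroupOfForm (starRingEnd ℂ) J)) : GL (Fin 3) ℂ) : Matrix (Fin 3) (Fin 3) ℂ),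
      ((((((η j).1 : ↥K) : ↥(unitaryGroupOfForm (starRingEnd ℂ) J))⁻¹ : ↥(unitaryGroupOfForm (starRingEnd ℂ) J)) : GL (Fin 3) ℂ) :
        Matrix (Fin 3) (Fin 3) ℂ))
  have hr : Continuous r := by
    refine continuous_pi fun j => ?_
    have hη : Continuous fun η : (↥S' → ↥K × ↥(unipotentU (starRingEnd ℂ) J)) => η j := continuous_apply j
    exact (hcoe.comp (continuous_subtype_val.comp (continuous_fst.comp hη))).prodMk
      ((hcoe.comp (continuous_subtype_val.comp (continuous_snd.comp hη))).prodMk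
        (hcoe.comp ((continuous_subtype_val.comp (continuous_fst.comp hη)).inv)))
  -- movers: smooth coordinate vectors, continuity in `U(J₃)(ℂ)`
  have hgm : ∀ j : ↥S', ContDiff ℝ ∞ fun c : {w : InfinitePlace L // IsComplex w} → Fin 3 → ℝ => (![0, c j.1 1, c j.1 2] : Fin 3 → ℝ) := fun j => by
    refine contDiff_pi.2 fun i => ?_
    fin_cases i
    · exact contDiff_const
    · exact contDiff_apply_apply ℝ ℝ j.1 1
    · exact contDiff_apply_apply ℝ ℝ j.1 2
  have hgs : ∀ j : ↥S', ContDiff ℝ ∞ fun c : {w : InfinitePlace L // IsComplex w} → Fin 3 → ℝ => (![c j.1 0 / 2, 0, 0] : Fin 3 → ℝ) := fun j => by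
    refine contDiff_pi.2 fun i => ?_
    fin_cases i
    · exact (contDiff_apply_apply ℝ ℝ j.1 0).div_const 2
    · exact contDiff_const
    · exact contDiff_const
  have hct : ∀ g : ({w : InfinitePlace L // IsComplex w} → Fin 3 → ℝ) → (Fin 3 → ℝ), ContDiff ℝ ∞ g →
      Continuous fun c => τ (g c) := fun g hg =>
    continuous_of_coe Complex.continuous_conj hJJ (contDiff_coe_torusFamily_comp τ hτcoe hg).continuous
  -- the integrand `F` and its smooth factorisation `Θ̃`
  obtain ⟨F, hFdef⟩ : ∃ F : (({w : InfinitePlace L // IsComplex w} → Fin 3 → ℝ) × Matrix (Fin 3) (Fin 3) ℂ) →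
      (∀ i : {w : {w : InfinitePlace L // IsComplex w} // w ∉ S' ∧ w ≠ w₀}, ↥(archLocal L 3 (Matrix.diagonal α) i.1)) →
      (↥S' → ↥K × ↥(unipotentU (starRingEnd ℂ) J)) → ℂ,
      F = fun q g η => φ (Matrix.of fun a b => ((0 : {w : InfinitePlace L // IsReal w} → ℝ),
        fun w : {w : InfinitePlace L // IsComplex w} =>
          if h : w ∈ S' then
            ((((T ⟨w, h⟩)⁻¹ : GL (Fin 3) ℂ) : Matrix (Fin 3) (Fin 3) ℂ) *
              (((((η ⟨w, h⟩).1 : ↥(unitaryGroupOfForm (starRingEnd ℂ) J)) *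
                  (τ ![0, q.1 w 1, q.1 w 2] * τ ![q.1 w 0 / 2, 0, 0] * ((η ⟨w, h⟩).2 : ↥(unitaryGroupOfForm (starRingEnd ℂ) J)) * τ ![q.1 w 0 / 2, 0, 0]) *
                  ((η ⟨w, h⟩).1 : ↥(unitaryGroupOfForm (starRingEnd ℂ) J))⁻¹ : ↥(unitaryGroupOfForm (starRingEnd ℂ) J)) : GL (Fin 3) ℂ) : Matrix (Fin 3) (Fin 3) ℂ) *
              ((T ⟨w, h⟩ : GL (Fin 3) ℂ) : Matrix (Fin 3) (Fin 3) ℂ)) a b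
          else if hw : w = w₀ then q.2 a b
          else ((((g ⟨w, ⟨h, hw⟩⟩ : ↥(archLocal L 3 (Matrix.diagonal α) w)) : GL (Fin 3) ℂ) : Matrix (Fin 3) (Fin 3) ℂ)) a b)) := ⟨_, rfl⟩
  -- the split word in matrix currency, as a function of (fibre matrices, coordinates)
  obtain ⟨word, hword⟩ : ∃ word : ↥S' → (Matrix (Fin 3) (Fin 3) ℂ × Matrix (Fin 3) (Fin 3) ℂ × Matrix (Fin 3) (Fin 3) ℂ) →
      ({w : InfinitePlace L // IsComplex w} → Fin 3 → ℝ) → Matrix (Fin 3) (Fin 3) ℂ,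
      word = fun j m c => (((T j)⁻¹ : GL (Fin 3) ℂ) : Matrix (Fin 3) (Fin 3) ℂ) *
        (m.1 * ((((τ ![0, c j.1 1, c j.1 2] : ↥(unitaryGroupOfForm (starRingEnd ℂ) J)) : GL (Fin 3) ℂ) : Matrix (Fin 3) (Fin 3) ℂ) *
          (((τ ![c j.1 0 / 2, 0, 0] : ↥(unitaryGroupOfForm (starRingEnd ℂ) J)) : GL (Fin 3) ℂ) : Matrix (Fin 3) (Fin 3) ℂ) * m.2.1 *
          (((τ ![c j.1 0 / 2, 0, 0] : ↥(unitaryGroupOfForm (starRingEnd ℂ) J)) : GL (Fin 3) ℂ) : Matrix (Fin 3) (Fin 3) ℂ)) * m.2.2) *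
        ((T j : GL (Fin 3) ℂ) : Matrix (Fin 3) (Fin 3) ℂ) := ⟨_, rfl⟩
  have hwordd : ∀ j : ↥S', ContDiff ℝ ∞ fun s : (Matrix (Fin 3) (Fin 3) ℂ × Matrix (Fin 3) (Fin 3) ℂ × Matrix (Fin 3) (Fin 3) ℂ) ×
      ({w : InfinitePlace L // IsComplex w} → Fin 3 → ℝ) => word j s.1 s.2 := by
    intro j
    rw [hword]
    have hm := contDiff_coe_torusFamily_comp τ hτcoe ((hgm j).comp (contDiff_snd (E := Matrix (Fin 3) (Fin 3) ℂ × Matrix (Fin 3) (Fin 3) ℂ × Matrix (Fin 3) (Fin 3) ℂ)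
      (F := {w : InfinitePlace L // IsComplex w} → Fin 3 → ℝ)))
    have hs := contDiff_coe_torusFamily_comp τ hτcoe ((hgs j).comp (contDiff_snd (E := Matrix (Fin 3) (Fin 3) ℂ × Matrix (Fin 3) (Fin 3) ℂ × Matrix (Fin 3) (Fin 3) ℂ)
      (F := {w : InfinitePlace L // IsComplex w} → Fin 3 → ℝ)))
    exact (contDiff_const.mul (((contDiff_fst.comp contDiff_fst).mul (((hm.mul hs).mul (contDiff_fst.comp (contDiff_snd.comp contDiff_fst))).mul hs)).mul
      (contDiff_snd.comp (contDiff_snd.comp contDiff_fst)))).mul contDiff_const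
  obtain ⟨Θ, hΘdef⟩ : ∃ Θ : (({w : {w : InfinitePlace L // IsComplex w} // w ∉ S' ∧ w ≠ w₀} → Matrix (Fin 3) (Fin 3) ℂ) ×
        (↥S' → Matrix (Fin 3) (Fin 3) ℂ × Matrix (Fin 3) (Fin 3) ℂ × Matrix (Fin 3) (Fin 3) ℂ)) ×
        (({w : InfinitePlace L // IsComplex w} → Fin 3 → ℝ) × Matrix (Fin 3) (Fin 3) ℂ) → ℂ,
      Θ = fun s => φ (Λ (s.2.2, (s.1.1, fun j => word j (s.1.2 j) s.2.1))) := ⟨_, rfl⟩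
  have hΘ : ContDiff ℝ ∞ Θ := by
    rw [hΘdef]
    refine hφ.comp (hΛ.comp ((contDiff_snd.comp contDiff_snd).prodMk ((contDiff_fst.comp contDiff_fst).prodMk ?_)))
    refine contDiff_pi.2 fun j => ?_
    have hD : ContDiff ℝ ∞ fun s : (({w : {w : InfinitePlace L // IsComplex w} // w ∉ S' ∧ w ≠ w₀} → Matrix (Fin 3) (Fin 3) ℂ) ×
        (↥S' → Matrix (Fin 3) (Fin 3) ℂ × Matrix (Fin 3) (Fin 3) ℂ × Matrix (Fin 3) (Fin 3) ℂ)) ×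
        (({w : InfinitePlace L // IsComplex w} → Fin 3 → ℝ) × Matrix (Fin 3) (Fin 3) ℂ) => (s.1.2 j, s.2.1) :=
      ((contDiff_apply ℝ (Matrix (Fin 3) (Fin 3) ℂ × Matrix (Fin 3) (Fin 3) ℂ × Matrix (Fin 3) (Fin 3) ℂ) j).comp (contDiff_snd.comp contDiff_fst)).prodMk
        (contDiff_fst.comp contDiff_snd)
    exact (hwordd j).comp hD
  have hFΘ : ∀ q g η, F q g η = Θ (((fun i => (((g i : ↥(archLocal L 3 (Matrix.diagonal α) i.1)) : GL (Fin 3) ℂ) : Matrix (Fin 3) (Fin 3) ℂ)), r η), q) := by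
    intro q g η
    rw [hFdef, hΘdef]
    simp only
    rw [hΛapply]
    congr 1
    refine Matrix.ext fun a b => Prod.ext rfl (funext fun w => ?_)
    simp only [Matrix.of_apply]
    by_cases h : w ∈ S'
    · rw [dif_pos h, dif_pos h, hword]
      simp only [r, Subgroup.coe_mul, Units.val_mul, Matrix.mul_assoc]
    · rw [dif_neg h, dif_neg h]
  -- block readers and the matrix-side compacts
  set Kφ : Set (Matrix (Fin 3) (Fin 3) (mixedSpace L)) := tsupport φ with hKφ
  have hKφc : IsCompact Kφ := hφc
  have hread : ∀ w : {w : InfinitePlace L // IsComplex w},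
      Continuous fun M : Matrix (Fin 3) (Fin 3) (mixedSpace L) => (Matrix.of fun a b => (M a b).2 w : Matrix (Fin 3) (Fin 3) ℂ) := continuous_readBlock L
  have hreadg : ∀ (X : Matrix (Fin 3) (Fin 3) ℂ) (mg : {w : {w : InfinitePlace L // IsComplex w} // w ∉ S' ∧ w ≠ w₀} → Matrix (Fin 3) (Fin 3) ℂ)
      (mu : ↥S' → Matrix (Fin 3) (Fin 3) ℂ) (i : {w : {w : InfinitePlace L // IsComplex w} // w ∉ S' ∧ w ≠ w₀}),
      (Matrix.of fun a b => (Λ (X, (mg, mu)) a b).2 i.1 : Matrix (Fin 3) (Fin 3) ℂ) = mg i := by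
    intro X mg mu i
    rw [hΛapply]
    ext a b
    simp only [Matrix.of_apply]
    rw [dif_neg i.2.1, dif_neg i.2.2]
  have hreadu : ∀ (X : Matrix (Fin 3) (Fin 3) ℂ) (mg : {w : {w : InfinitePlace L // IsComplex w} // w ∉ S' ∧ w ≠ w₀} → Matrix (Fin 3) (Fin 3) ℂ)
      (mu : ↥S' → Matrix (Fin 3) (Fin 3) ℂ) (j : ↥S'),
      (Matrix.of fun a b => (Λ (X, (mg, mu)) a b).2 j.1 : Matrix (Fin 3) (Fin 3) ℂ) = mu j := by
    intro X mg mu j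
    rw [hΛapply]
    ext a b
    simp only [Matrix.of_apply]
    rw [dif_pos j.2]
  -- the support clause of ★ (A4′), read matrix-side
  have hFsupp : ∀ K₀ ⊆ {c : {w : InfinitePlace L // IsComplex w} → Fin 3 → ℝ |
        ∀ (i : {w : {w : InfinitePlace L // IsComplex w} // w ∉ S' ∧ w ≠ w₀}) (a b : Fin 3), a ≠ b →
          slotSign L α i.1 a ≠ slotSign L α i.1 b → Circle.exp (c i.1 a) ≠ Circle.exp (c i.1 b)} ×ˢ (univ : Set (Matrix (Fin 3) (Fin 3) ℂ)),
      IsCompact K₀ → ∃ A : Set (∀ i : {w : {w : InfinitePlace L // IsComplex w} // w ∉ S' ∧ w ≠ w₀}, ↥(archLocal L 3 (Matrix.diagonal α) i.1)),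
        ∃ Y₀ : Set (↥S' → ↥K × ↥(unipotentU (starRingEnd ℂ) J)), IsCompact A ∧ IsCompact Y₀ ∧ ∀ q ∈ K₀, ∀ g η, F q g η ≠ 0 → g ∈ A ∧ η ∈ Y₀ := by
    intro K₀ _ hK₀
    -- the compact-place slots
    have hA : IsCompact (Set.pi Set.univ fun i : {w : {w : InfinitePlace L // IsComplex w} // w ∉ S' ∧ w ≠ w₀} =>
        {h : ↥(archLocal L 3 (Matrix.diagonal α) i.1) | ((h : GL (Fin 3) ℂ) : Matrix (Fin 3) (Fin 3) ℂ) ∈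
          (fun M : Matrix (Fin 3) (Fin 3) (mixedSpace L) => (Matrix.of fun a b => (M a b).2 i.1 : Matrix (Fin 3) (Fin 3) ℂ)) '' Kφ}) :=
      isCompact_univ_pi fun i => isCompact_setOf_coe_archLocal_mem L 3 α i.1 hα (hKφc.image (hread i.1))
    -- the split slots: `u_j` in a compact of `U(J)`, then `n_j` in a compact of `N`
    have hB : ∀ j : ↥S', IsCompact {u : ↥(unitaryGroupOfForm (starRingEnd ℂ) J) | ((u : GL (Fin 3) ℂ) : Matrix (Fin 3) (Fin 3) ℂ) ∈
        (fun M => ((T j : GL (Fin 3) ℂ) : Matrix (Fin 3) (Fin 3) ℂ) * M * (((T j)⁻¹ : GL (Fin 3) ℂ) : Matrix (Fin 3) (Fin 3) ℂ)) ''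
          ((fun M : Matrix (Fin 3) (Fin 3) (mixedSpace L) => (Matrix.of fun a b => (M a b).2 j.1 : Matrix (Fin 3) (Fin 3) ℂ)) '' Kφ)} := fun j =>
      (isClosedEmbedding_coe_unitaryGroupOfForm J hJdet).isCompact_preimage
        (((hKφc.image (hread j.1)).image ((continuous_const.mul continuous_id).mul continuous_const)))
    have hKc : IsCompact (Prod.fst '' K₀) := hK₀.image continuous_fst
    have hΞ : ∀ j : ↥S', ∃ N₀ : Set ↥(unipotentU (starRingEnd ℂ) J), IsCompact N₀ ∧
        ∀ c ∈ Prod.fst '' K₀, ∀ (k : ↥K) (n : ↥(unipotentU (starRingEnd ℂ) J)),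
          ((k : ↥(unitaryGroupOfForm (starRingEnd ℂ) J)) *
            (τ ![0, c j.1 1, c j.1 2] * τ ![c j.1 0 / 2, 0, 0] * (n : ↥(unitaryGroupOfForm (starRingEnd ℂ) J)) * τ ![c j.1 0 / 2, 0, 0]) *
            (k : ↥(unitaryGroupOfForm (starRingEnd ℂ) J))⁻¹) ∈
            {u : ↥(unitaryGroupOfForm (starRingEnd ℂ) J) | ((u : GL (Fin 3) ℂ) : Matrix (Fin 3) (Fin 3) ℂ) ∈
              (fun M => ((T j : GL (Fin 3) ℂ) : Matrix (Fin 3) (Fin 3) ℂ) * M * (((T j)⁻¹ : GL (Fin 3) ℂ) : Matrix (Fin 3) (Fin 3) ℂ)) ''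
                ((fun M : Matrix (Fin 3) (Fin 3) (mixedSpace L) => (Matrix.of fun a b => (M a b).2 j.1 : Matrix (Fin 3) (Fin 3) ℂ)) '' Kφ)} → n ∈ N₀ := by
      intro j
      obtain ⟨Ξ, hΞdef⟩ : ∃ Ξ : (({w : InfinitePlace L // IsComplex w} → Fin 3 → ℝ) × ↥(unitaryGroupOfForm (starRingEnd ℂ) J)) ×
          ↥(unitaryGroupOfForm (starRingEnd ℂ) J) → ↥(unitaryGroupOfForm (starRingEnd ℂ) J),
          Ξ = fun s => (τ ![0, s.1.1 j.1 1, s.1.1 j.1 2] * τ ![s.1.1 j.1 0 / 2, 0, 0])⁻¹ * ((s.1.2)⁻¹ * s.2 * s.1.2) *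
            (τ ![s.1.1 j.1 0 / 2, 0, 0])⁻¹ := ⟨_, rfl⟩
      have hΞc : Continuous Ξ := by
        rw [hΞdef]
        have h1 : Continuous fun s : (({w : InfinitePlace L // IsComplex w} → Fin 3 → ℝ) × ↥(unitaryGroupOfForm (starRingEnd ℂ) J)) ×
            ↥(unitaryGroupOfForm (starRingEnd ℂ) J) => τ ![0, s.1.1 j.1 1, s.1.1 j.1 2] :=
          (hct _ (hgm j)).comp (continuous_fst.comp continuous_fst)
        have h2 : Continuous fun s : (({w : InfinitePlace L // IsComplex w} → Fin 3 → ℝ) × ↥(unitaryGroupOfForm (starRingEnd ℂ) J)) ×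
            ↥(unitaryGroupOfForm (starRingEnd ℂ) J) => τ ![s.1.1 j.1 0 / 2, 0, 0] :=
          (hct _ (hgs j)).comp (continuous_fst.comp continuous_fst)
        have hk : Continuous fun s : (({w : InfinitePlace L // IsComplex w} → Fin 3 → ℝ) × ↥(unitaryGroupOfForm (starRingEnd ℂ) J)) ×
            ↥(unitaryGroupOfForm (starRingEnd ℂ) J) => s.1.2 := continuous_snd.comp continuous_fst
        exact ((h1.mul h2).inv.mul ((hk.inv.mul continuous_snd).mul hk)).mul h2.inv
      refine ⟨Subtype.val ⁻¹' (Ξ '' (((Prod.fst '' K₀) ×ˢ (K : Set ↥(unitaryGroupOfForm (starRingEnd ℂ) J))) ×ˢ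
          {u : ↥(unitaryGroupOfForm (starRingEnd ℂ) J) | ((u : GL (Fin 3) ℂ) : Matrix (Fin 3) (Fin 3) ℂ) ∈
            (fun M => ((T j : GL (Fin 3) ℂ) : Matrix (Fin 3) (Fin 3) ℂ) * M * (((T j)⁻¹ : GL (Fin 3) ℂ) : Matrix (Fin 3) (Fin 3) ℂ)) ''
              ((fun M : Matrix (Fin 3) (Fin 3) (mixedSpace L) => (Matrix.of fun a b => (M a b).2 j.1 : Matrix (Fin 3) (Fin 3) ℂ)) '' Kφ)})),
        hN.isClosedEmbedding_subtypeVal.isCompact_preimage (((hKc.prod hK).prod (hB j)).image hΞc), ?_⟩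
      intro c hc k n hu
      refine ⟨((c, (k : ↥(unitaryGroupOfForm (starRingEnd ℂ) J))), _), Set.mk_mem_prod (Set.mk_mem_prod hc k.2) hu, ?_⟩
      rw [hΞdef]
      simp only
      group
    choose N₀ hN₀c hN₀ using hΞ
    refine ⟨_, Set.pi Set.univ fun j => (Set.univ : Set ↥K) ×ˢ N₀ j, hA, isCompact_univ_pi fun j => isCompact_univ.prod (hN₀c j), ?_⟩
    intro q hq g η hne
    -- `φ ≠ 0` ⇒ the recombined matrix lies in `tsupport φ`
    have hmem : Λ (q.2, ((fun i => (((g i : ↥(archLocal L 3 (Matrix.diagonal α) i.1)) : GL (Fin 3) ℂ) : Matrix (Fin 3) (Fin 3) ℂ)),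
        fun j => word j (r η j) q.1)) ∈ Kφ := by
      rw [hFΘ, hΘdef] at hne
      exact subset_tsupport _ (Function.mem_support.2 hne)
    refine ⟨Set.mem_univ_pi.2 fun i => ⟨_, hmem, hreadg _ _ _ i⟩, Set.mem_univ_pi.2 fun j => Set.mk_mem_prod (Set.mem_univ _) ?_⟩
    refine hN₀ j q.1 ⟨q, hq, rfl⟩ (η j).1 (η j).2 ⟨word j (r η j) q.1, ⟨_, hmem, hreadu _ _ _ j⟩, ?_⟩
    have hcancel : ∀ (u : GL (Fin 3) ℂ) (M : Matrix (Fin 3) (Fin 3) ℂ),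
        (u : Matrix (Fin 3) (Fin 3) ℂ) * (((u⁻¹ : GL (Fin 3) ℂ) : Matrix (Fin 3) (Fin 3) ℂ) * M * (u : Matrix (Fin 3) (Fin 3) ℂ)) *
          ((u⁻¹ : GL (Fin 3) ℂ) : Matrix (Fin 3) (Fin 3) ℂ) = M := by
      intro u M
      rw [← Matrix.mul_assoc, ← Matrix.mul_assoc, Units.mul_inv, Matrix.one_mul, Matrix.mul_assoc, Units.mul_inv, Matrix.mul_one]
    show ((T j : GL (Fin 3) ℂ) : Matrix (Fin 3) (Fin 3) ℂ) * word j (r η j) q.1 * (((T j)⁻¹ : GL (Fin 3) ℂ) : Matrix (Fin 3) (Fin 3) ℂ) = _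
    rw [hword]
    simp only [r]
    rw [hcancel]
    simp only [Subgroup.coe_mul, Units.val_mul, Matrix.mul_assoc]
  -- ONE call of ★ (A4′) (prefactor `1`), then unfold `F`
  have key := contDiffOn_smoothModel_prod_param L α S' hα hreal hS'
    (fun i : {w : {w : InfinitePlace L // IsComplex w} // w ∉ S' ∧ w ≠ w₀} => i.1) (fun i => i.2.1) μ ν isOpen_univ r hr F Θ hΘ hFΘ hFsupp
    (fun _ => (1 : ℂ)) contDiffOn_const
  refine key.congr fun q _ => ?_
  rw [one_mul, hFdef]

omit [NumberField L] [IsCMField L] in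
/-- **UNIFORM COMPACT `G_{w₀}`-SUPPORT OF THE PARTIAL UNFOLDED MODEL** (the `hΘc` binder of ★ J1 `…_of_centralModel`): there is ONE compact `C ⊆ U(α)_{w₀}` such that for EVERY
coordinate `c` and every `k ∉ C` the partial unfolded model vanishes at `(c, ↑↑k)` — indeed the INTEGRAND vanishes identically: the `w₀`-block of the recombined matrix is `↑↑k`, which is
off the (compact) `w₀`-block of `tsupport φ̃`, pulled back to the group by ★ `isCompact_setOf_coe_archLocal_mem`. [cite: Rogawski1990, §8.2 p. 122] [cite: DeitmarEchterhoff2014, Lemma 9.3.3] -/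
theorem exists_isCompact_partialUnfoldedModel_integrand_eq_zero (hα : ∀ i, α i ≠ 0) (hw₀ : w₀ ∉ S')
    (T : ↥S' → GL (Fin 3) ℂ) (φ : Matrix (Fin 3) (Fin 3) (mixedSpace L) → ℂ) (hφc : HasCompactSupport φ) :
    ∃ C : Set ↥(archLocal L 3 (Matrix.diagonal α) w₀), IsCompact C ∧
      ∀ (k : ↥(archLocal L 3 (Matrix.diagonal α) w₀)), k ∉ C →
        ∀ (mu : ↥S' → Matrix (Fin 3) (Fin 3) ℂ) (g : ∀ i : {w : {w : InfinitePlace L // IsComplex w} // w ∉ S' ∧ w ≠ w₀}, ↥(archLocal L 3 (Matrix.diagonal α) i.1)),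
          φ (Matrix.of fun a b => ((0 : {w : InfinitePlace L // IsReal w} → ℝ),
            fun w : {w : InfinitePlace L // IsComplex w} =>
              if h : w ∈ S' then ((((T ⟨w, h⟩)⁻¹ : GL (Fin 3) ℂ) : Matrix (Fin 3) (Fin 3) ℂ) * mu ⟨w, h⟩ * ((T ⟨w, h⟩ : GL (Fin 3) ℂ) : Matrix (Fin 3) (Fin 3) ℂ)) a b
              else if hw : w = w₀ then ((k : GL (Fin 3) ℂ) : Matrix (Fin 3) (Fin 3) ℂ) a b
              else ((((g ⟨w, ⟨h, hw⟩⟩ : ↥(archLocal L 3 (Matrix.diagonal α) w)) : GL (Fin 3) ℂ) : Matrix (Fin 3) (Fin 3) ℂ)) a b)) = 0 := by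
  have hread := continuous_readBlock L w₀
  refine ⟨{k : ↥(archLocal L 3 (Matrix.diagonal α) w₀) | ((k : GL (Fin 3) ℂ) : Matrix (Fin 3) (Fin 3) ℂ) ∈
      (fun M : Matrix (Fin 3) (Fin 3) (mixedSpace L) => (Matrix.of fun a b => (M a b).2 w₀ : Matrix (Fin 3) (Fin 3) ℂ)) '' tsupport φ},
    isCompact_setOf_coe_archLocal_mem L 3 α w₀ hα (hφc.image hread), fun k hk mu g => ?_⟩
  refine image_eq_zero_of_notMem_tsupport fun hmem => hk ⟨_, hmem, ?_⟩
  ext a b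
  simp only [Matrix.of_apply, dif_neg hw₀, dite_true]

end PartialModel

end Literature.NumberTheory.Automorphic.UnitaryGroup

end
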